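import Mathlib.Logic.Function.DependsOn
import Mathlib.Analysis.Convex.SpecificFunctions.Basic
import Literature.Probability.Moments.McDiarmidWeighted
import HarnessLib

/-!
# Definability gap, ROAD P: independence of disjoint coordinate blocks and a Chernoff lower tail
# (N1 v2 (c))

Generic probability bookkeeping for the finite product laws `prodWeight w` of
`Literature.Probability.Moments.McDiarmidWeighted`, needed by step (c) of the existence proof of
pivot certificates (NODE-v7 §H / PLAN-N1-v2, the sparse-subfamily argument on crowded lines: the
events "curve `j` is privately free" are determined by pairwise DISJOINT blocks of coordinates,
hence independent, and their number obeys a Chernoff lower tail).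

* `sum_prodWeight_mul_wCoordAvg` — the tower property `E[E_S F] = E[F]` of the coordinate
  averaging operator `wCoordAvg`;
* `wCoordAvg_mul_of_dependsOn_compl`, `wCoordAvg_of_dependsOn` — a function of the kept
  coordinates factors out of `E_S`; a function of the averaged coordinates averages to `E[F]`;
* `sum_prodWeight_mul_mul_of_dependsOn` — **product rule** `E[F G] = E[F] E[G]` for `F`
  depending on `S` and `G` on `Sᶜ` (Mathlib's `DependsOn`);
* `sum_prodWeight_mul_prod_of_dependsOn` — `E[∏_j g_j] = ∏_j E[g_j]` for functions of pairwise
  disjoint coordinate blocks;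
* `weight_blockSum_le_exp` — **Chernoff lower tail**: for `[0,1]`-valued block functions,
  `W{Σ_j g_j ≤ a} ≤ exp(λ a − (1 − e^{−λ}) Σ_j E[g_j])` (`λ ≥ 0`), and the packaged
  `weight_blockSum_le_half : W{Σ_j g_j ≤ μ/2} ≤ exp(−μ/8)`.
-/

namespace Summit.ValiantsHypothesis.ValiantsHypothesis.Theorems.DefinabilityGapBlockIndependence

open Finset Real Literature.Probability.Moments

variable {ι Γ : Type*} [Fintype ι] [DecidableEq ι] [Fintype Γ]

/-! ## Tower property and the product rule -/

/-- **Tower property** `E[E_S F] = E[F]`: averaging the coordinates in `S` afresh and then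
taking the full expectation is the full expectation. [lens-5 g7] -/
theorem sum_prodWeight_mul_wCoordAvg {w : ι → Γ → ℝ} (hw1 : ∀ i, ∑ a, w i a = 1)
    (S : Finset ι) (F : (ι → Γ) → ℝ) :
    ∑ y, prodWeight w y * wCoordAvg w S F y = ∑ y, prodWeight w y * F y := by
  induction S using Finset.induction_on with
  | empty => simp only [wCoordAvg_empty hw1]
  | @insert k S hk ih =>
      rw [← ih]
      refine (Finset.sum_congr rfl fun y _ => by
        rw [← sum_mul_wCoordAvg_update hw1 hk F y]).trans ?_
      exact (sum_prodWeight_mul_eq_sum_resample hw1 k (wCoordAvg w S F)).symm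

/-- A function of the KEPT coordinates factors out of `E_S`. [lens-5 g7] -/
theorem wCoordAvg_mul_of_dependsOn_compl (w : ι → Γ → ℝ) (S : Finset ι)
    {F G : (ι → Γ) → ℝ} (hG : DependsOn G ((↑S : Set ι)ᶜ)) (y : ι → Γ) :
    wCoordAvg w S (fun z => F z * G z) y = wCoordAvg w S F y * G y := by
  rw [wCoordAvg_apply, wCoordAvg_apply, Finset.sum_mul]
  refine Finset.sum_congr rfl fun z _ => ?_
  have hGz : G (S.piecewise z y) = G y :=
    hG fun i hi => Finset.piecewise_eq_of_notMem _ _ _ (by simpa using hi)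
  rw [hGz, mul_assoc]

/-- A function of the AVERAGED coordinates averages to the constant `E[F]`. [lens-5 g7] -/
theorem wCoordAvg_of_dependsOn (w : ι → Γ → ℝ) (S : Finset ι) {F : (ι → Γ) → ℝ}
    (hF : DependsOn F (↑S : Set ι)) (y : ι → Γ) :
    wCoordAvg w S F y = ∑ z, prodWeight w z * F z := by
  rw [wCoordAvg_apply]
  refine Finset.sum_congr rfl fun z _ => ?_
  rw [hF (fun i hi => Finset.piecewise_eq_of_mem _ _ _ (by simpa using hi))]

/-- **Product rule**: if `F` depends only on the coordinates in `S` and `G` only on those outside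
`S`, then `E[F G] = E[F] · E[G]` under the product law. [lens-5 g7] -/
theorem sum_prodWeight_mul_mul_of_dependsOn {w : ι → Γ → ℝ} (hw1 : ∀ i, ∑ a, w i a = 1)
    (S : Finset ι) {F G : (ι → Γ) → ℝ} (hF : DependsOn F (↑S : Set ι))
    (hG : DependsOn G ((↑S : Set ι)ᶜ)) :
    ∑ y, prodWeight w y * (F y * G y) =
      (∑ y, prodWeight w y * F y) * ∑ y, prodWeight w y * G y := by
  have h1 := sum_prodWeight_mul_wCoordAvg hw1 S (fun y => F y * G y)
  beta_reduce at h1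
  rw [← h1]
  simp_rw [wCoordAvg_mul_of_dependsOn_compl w S hG, wCoordAvg_of_dependsOn w S hF]
  rw [Finset.mul_sum]
  exact Finset.sum_congr rfl fun y _ => by ring

/-! ## Pairwise disjoint blocks -/

omit [Fintype ι] [DecidableEq ι] [Fintype Γ] in
/-- A product of functions of blocks disjoint from `S` depends only on `Sᶜ`. [lens-5 g7] -/
theorem dependsOn_prod_compl {κ : Type*} (J : Finset κ) (B : κ → Finset ι)
    (g : κ → (ι → Γ) → ℝ) (hg : ∀ j ∈ J, DependsOn (g j) (↑(B j) : Set ι)) (S : Finset ι)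
    (hS : ∀ j ∈ J, Disjoint (B j) S) :
    DependsOn (fun y => ∏ j ∈ J, g j y) ((↑S : Set ι)ᶜ) := by
  intro y y' hyy'
  refine Finset.prod_congr rfl fun j hj => hg j hj fun i hi => hyy' i ?_
  have hi' : i ∈ B j := by simpa using hi
  simp only [Set.mem_compl_iff, Finset.mem_coe]
  exact Finset.disjoint_left.mp (hS j hj) hi'

/-- **Independence of disjoint blocks**: `E[∏_{j ∈ J} g_j] = ∏_{j ∈ J} E[g_j]` when each `g_j`
depends only on the block `B j` and the blocks are pairwise disjoint. [lens-5 g7] -/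
theorem sum_prodWeight_mul_prod_of_dependsOn {κ : Type*} [DecidableEq κ] {w : ι → Γ → ℝ}
    (hw1 : ∀ i, ∑ a, w i a = 1) (J : Finset κ) (B : κ → Finset ι)
    (hB : ∀ j ∈ J, ∀ j' ∈ J, j ≠ j' → Disjoint (B j) (B j')) (g : κ → (ι → Γ) → ℝ)
    (hg : ∀ j ∈ J, DependsOn (g j) (↑(B j) : Set ι)) :
    ∑ y, prodWeight w y * ∏ j ∈ J, g j y = ∏ j ∈ J, ∑ y, prodWeight w y * g j y := by
  induction J using Finset.induction_on with
  | empty => simp [sum_prodWeight hw1]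
  | @insert k J hk ih =>
      have hB' : ∀ j ∈ J, ∀ j' ∈ J, j ≠ j' → Disjoint (B j) (B j') := fun j hj j' hj' =>
        hB j (Finset.mem_insert_of_mem hj) j' (Finset.mem_insert_of_mem hj')
      have hg' : ∀ j ∈ J, DependsOn (g j) (↑(B j) : Set ι) := fun j hj =>
        hg j (Finset.mem_insert_of_mem hj)
      have hdisj : ∀ j ∈ J, Disjoint (B j) (B k) := fun j hj =>
        hB j (Finset.mem_insert_of_mem hj) k (Finset.mem_insert_self k J)
          (fun h => hk (h ▸ hj))
      rw [Finset.prod_insert hk]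
      simp_rw [Finset.prod_insert hk]
      rw [sum_prodWeight_mul_mul_of_dependsOn hw1 (B k) (hg k (Finset.mem_insert_self k J))
        (dependsOn_prod_compl J B g hg' (B k) hdisj), ih hB' hg']

/-! ## Chernoff lower tail for sums of `[0,1]`-valued block functions -/

/-- Convexity: `exp(−λ x) ≤ 1 − (1 − e^{−λ}) x` for `x ∈ [0, 1]`. [lens-5 g7] -/
theorem exp_neg_mul_le_of_mem_unit (l : ℝ) {x : ℝ} (hx0 : 0 ≤ x) (hx1 : x ≤ 1) :
    exp (-(l * x)) ≤ 1 - (1 - exp (-l)) * x := by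
  have h := convexOn_exp.2 (Set.mem_univ (0 : ℝ)) (Set.mem_univ (-l)) (sub_nonneg.mpr hx1) hx0
    (by ring)
  simp only [smul_eq_mul, mul_zero, zero_add, Real.exp_zero, mul_one] at h
  have harg : x * -l = -(l * x) := by ring
  rw [harg] at h
  linarith

/-- One block: `E[exp(−λ g)] ≤ exp(−(1 − e^{−λ}) E[g])` for `g ∈ [0,1]`. [lens-5 g7] -/
theorem sum_prodWeight_mul_exp_neg_le {w : ι → Γ → ℝ} (hw : ∀ i a, 0 ≤ w i a)
    (hw1 : ∀ i, ∑ a, w i a = 1) (g : (ι → Γ) → ℝ) (hg0 : ∀ y, 0 ≤ g y) (hg1 : ∀ y, g y ≤ 1)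
    (l : ℝ) :
    ∑ y, prodWeight w y * exp (-(l * g y)) ≤
      exp (-((1 - exp (-l)) * ∑ y, prodWeight w y * g y)) := by
  calc ∑ y, prodWeight w y * exp (-(l * g y))
      ≤ ∑ y, prodWeight w y * (1 - (1 - exp (-l)) * g y) :=
        Finset.sum_le_sum fun y _ => mul_le_mul_of_nonneg_left
          (exp_neg_mul_le_of_mem_unit l (hg0 y) (hg1 y)) (prodWeight_nonneg hw y)
    _ = 1 - (1 - exp (-l)) * ∑ y, prodWeight w y * g y := by
        rw [Finset.mul_sum, ← sum_prodWeight hw1, ← Finset.sum_sub_distrib, sum_prodWeight hw1]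
        exact Finset.sum_congr rfl fun y _ => by ring
    _ ≤ exp (-((1 - exp (-l)) * ∑ y, prodWeight w y * g y)) := Real.one_sub_le_exp_neg _

/-- **Chernoff lower tail for block sums.**  `g_j ∈ [0,1]` depends only on the block `B j`, the
blocks are pairwise disjoint, `λ ≥ 0`: the `prodWeight w`-weight of `{y : Σ_j g_j(y) ≤ a}` is at
most `exp(λ a − (1 − e^{−λ}) Σ_j E[g_j])`. [lens-5 g7] -/
theorem weight_blockSum_le_exp {κ : Type*} [DecidableEq κ] {w : ι → Γ → ℝ}
    (hw : ∀ i a, 0 ≤ w i a) (hw1 : ∀ i, ∑ a, w i a = 1) (J : Finset κ) (B : κ → Finset ι)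
    (hB : ∀ j ∈ J, ∀ j' ∈ J, j ≠ j' → Disjoint (B j) (B j')) (g : κ → (ι → Γ) → ℝ)
    (hg : ∀ j ∈ J, DependsOn (g j) (↑(B j) : Set ι)) (hg0 : ∀ j ∈ J, ∀ y, 0 ≤ g j y)
    (hg1 : ∀ j ∈ J, ∀ y, g j y ≤ 1) {l : ℝ} (hl : 0 ≤ l) (a : ℝ) :
    ∑ y ∈ (Finset.univ : Finset (ι → Γ)).filter (fun y => ∑ j ∈ J, g j y ≤ a), prodWeight w y
      ≤ exp (l * a - (1 - exp (-l)) * ∑ j ∈ J, ∑ y, prodWeight w y * g j y) := by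
  -- Markov / exponential moment
  have hstep1 : ∑ y ∈ (Finset.univ : Finset (ι → Γ)).filter (fun y => ∑ j ∈ J, g j y ≤ a),
      prodWeight w y ≤ ∑ y, prodWeight w y * exp (l * (a - ∑ j ∈ J, g j y)) := by
    calc ∑ y ∈ (Finset.univ : Finset (ι → Γ)).filter (fun y => ∑ j ∈ J, g j y ≤ a),
          prodWeight w y
        ≤ ∑ y ∈ (Finset.univ : Finset (ι → Γ)).filter (fun y => ∑ j ∈ J, g j y ≤ a),
            prodWeight w y * exp (l * (a - ∑ j ∈ J, g j y)) := by
          refine Finset.sum_le_sum fun y hy => ?_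
          rw [Finset.mem_filter] at hy
          have h1 : (1 : ℝ) ≤ exp (l * (a - ∑ j ∈ J, g j y)) :=
            Real.one_le_exp (mul_nonneg hl (sub_nonneg.mpr hy.2))
          nlinarith [prodWeight_nonneg hw y]
      _ ≤ ∑ y, prodWeight w y * exp (l * (a - ∑ j ∈ J, g j y)) :=
          Finset.sum_le_sum_of_subset_of_nonneg (Finset.filter_subset _ _)
            fun y _ _ => mul_nonneg (prodWeight_nonneg hw y) (Real.exp_nonneg _)
  -- factorise the exponential moment over the blocks
  have hfact : ∑ y, prodWeight w y * exp (l * (a - ∑ j ∈ J, g j y)) =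
      exp (l * a) * ∏ j ∈ J, ∑ y, prodWeight w y * exp (-(l * g j y)) := by
    have hdep : ∀ j ∈ J, DependsOn (fun y => exp (-(l * g j y))) (↑(B j) : Set ι) :=
      fun j hj y y' h => by simp only [hg j hj h]
    rw [← sum_prodWeight_mul_prod_of_dependsOn hw1 J B hB (fun j y => exp (-(l * g j y))) hdep,
      Finset.mul_sum]
    refine Finset.sum_congr rfl fun y _ => ?_
    have hsum : -(l * ∑ j ∈ J, g j y) = ∑ j ∈ J, (-(l * g j y)) := by
      rw [Finset.mul_sum, ← Finset.sum_neg_distrib]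
    rw [mul_sub, sub_eq_add_neg, Real.exp_add, hsum, Real.exp_sum]
    ring
  -- bound each factor
  have hprod : ∏ j ∈ J, ∑ y, prodWeight w y * exp (-(l * g j y)) ≤
      ∏ j ∈ J, exp (-((1 - exp (-l)) * ∑ y, prodWeight w y * g j y)) :=
    Finset.prod_le_prod (fun j _ => Finset.sum_nonneg fun y _ =>
        mul_nonneg (prodWeight_nonneg hw y) (Real.exp_nonneg _))
      fun j hj => sum_prodWeight_mul_exp_neg_le hw hw1 (g j) (hg0 j hj) (hg1 j hj) l
  calc ∑ y ∈ (Finset.univ : Finset (ι → Γ)).filter (fun y => ∑ j ∈ J, g j y ≤ a),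
        prodWeight w y
      ≤ exp (l * a) * ∏ j ∈ J, ∑ y, prodWeight w y * exp (-(l * g j y)) := by
        rw [← hfact]; exact hstep1
    _ ≤ exp (l * a) * ∏ j ∈ J, exp (-((1 - exp (-l)) * ∑ y, prodWeight w y * g j y)) :=
        mul_le_mul_of_nonneg_left hprod (Real.exp_nonneg _)
    _ = exp (l * a - (1 - exp (-l)) * ∑ j ∈ J, ∑ y, prodWeight w y * g j y) := by
        rw [← Real.exp_sum, ← Real.exp_add, Finset.mul_sum, Finset.sum_neg_distrib]
        congr 1

/-- `exp(−1/2) ≤ 8/13` (from `1 + x + x²/2 ≤ eˣ`). [lens-5 g7] -/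
theorem exp_neg_half_le : exp (-(1 / 2 : ℝ)) ≤ 8 / 13 := by
  have h := Real.quadratic_le_exp_of_nonneg (show (0 : ℝ) ≤ 1 / 2 by norm_num)
  have h13 : (13 / 8 : ℝ) ≤ exp (1 / 2) := by nlinarith [h]
  rw [Real.exp_neg]
  calc (exp (1 / 2))⁻¹ ≤ (13 / 8 : ℝ)⁻¹ := by
        exact inv_anti₀ (by norm_num) h13
    _ = 8 / 13 := by norm_num

/-- **Packaged lower tail**: with `μ = Σ_j E[g_j]`, the weight of `{Σ_j g_j ≤ μ/2}` is at most
`exp(−μ/8)` (`λ = 1/2` in `weight_blockSum_le_exp`). [lens-5 g7] -/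
theorem weight_blockSum_le_half {κ : Type*} [DecidableEq κ] {w : ι → Γ → ℝ}
    (hw : ∀ i a, 0 ≤ w i a) (hw1 : ∀ i, ∑ a, w i a = 1) (J : Finset κ) (B : κ → Finset ι)
    (hB : ∀ j ∈ J, ∀ j' ∈ J, j ≠ j' → Disjoint (B j) (B j')) (g : κ → (ι → Γ) → ℝ)
    (hg : ∀ j ∈ J, DependsOn (g j) (↑(B j) : Set ι)) (hg0 : ∀ j ∈ J, ∀ y, 0 ≤ g j y)
    (hg1 : ∀ j ∈ J, ∀ y, g j y ≤ 1) :
    ∑ y ∈ (Finset.univ : Finset (ι → Γ)).filter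
        (fun y => ∑ j ∈ J, g j y ≤ (∑ j ∈ J, ∑ y, prodWeight w y * g j y) / 2), prodWeight w y
      ≤ exp (-((∑ j ∈ J, ∑ y, prodWeight w y * g j y) / 8)) := by
  set μ := ∑ j ∈ J, ∑ y, prodWeight w y * g j y with hμ
  have hμ0 : 0 ≤ μ := Finset.sum_nonneg fun j hj => Finset.sum_nonneg fun y _ =>
    mul_nonneg (prodWeight_nonneg hw y) (hg0 j hj y)
  have h := weight_blockSum_le_exp hw hw1 J B hB g hg hg0 hg1
    (show (0 : ℝ) ≤ 1 / 2 by norm_num) (μ / 2)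
  refine h.trans (Real.exp_le_exp.mpr ?_)
  have he := exp_neg_half_le
  nlinarith [he, hμ0, Real.exp_nonneg (-(1 / 2 : ℝ))]

end Summit.ValiantsHypothesis.ValiantsHypothesis.Theorems.DefinabilityGapBlockIndependence
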